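import Literature.NumberTheory.PAdicHodge.BdRField
import Literature.NumberTheory.PAdicHodge.TateTwistInvariants
import Literature.NumberTheory.GaloisRepresentations.PAdicHodge
import Mathlib.Algebra.Ring.Action.Field
import HarnessLib

/-!
# `B_dR(F)` as a period-ring datum: `B_dR(F)^{Γ_F} = F`

Let `F` be a nonarchimedean local field of characteristic `0` with `v(p) < 1`. We assemble
Fontaine's field of `p`-adic periods `B_dR(F)` (files `FontaineThetaLocalField` … `BdRField`) into
a `PeriodRingData Γ_F ℚ_p F` (tree `Literature.NumberTheory.GaloisRepresentations.PeriodRingData`):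
a field with `Γ_F`-action, `F`-algebra structure and the filtration `Fil^i = ξ^i B_dR⁺`, and we
prove the regularity conditions, whose heart is

* **`invariants_eq` : `B_dR(F)^{Γ_F} = F`** (`fixedPoints_fracBdR_eq_range`). Proof (Fontaine 1994,
  Exp. II §1.5.7; Fontaine–Ouyang Thm. 5.2.6): a nonzero invariant `x = u^m w` (`u = [ε] − 1` the
  uniformizer, `w` a unit) gives, after applying `θ`, `χ(σ)^m · σ(θ w) = θ w` in `ℂ_F`; Tate's theorem
  `H⁰(Γ_F, ℂ_F(χ^j)) = 0` for `j ≠ 0` (tree `TateTwistInvariants`) forces `m = 0`; then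
  `θ x ∈ ℂ_F^{Γ_F} = F` (Ax–Sen–Tate, tree `AxSenTate`), and `x − θ x ∈ Fil¹` is again invariant, hence `0`.

Main definition: `bdRPeriodRingData hp : PeriodRingData (absoluteGaloisGroup F) ℚ_[p] F`.

## References
* [FontaineAsterisque223III] J.-M. Fontaine, *Le corps des périodes p-adiques*, Astérisque 223
  (1994), Exp. II, §1.5.5–1.5.7; Exp. III, §1.5.
* [FontaineOuyang2022] J.-M. Fontaine, Y. Ouyang, *Theory of p-adic Galois representations*
  (book draft), Thm. 5.2.6.
-/

noncomputable section

open ValuativeRel Field Ideal WittVector UniformSpace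
open Literature.AlgebraicGeometry.Resolution

namespace Literature.NumberTheory.PAdicHodge

open Literature.NumberTheory.GaloisRepresentations
open Literature.NumberTheory.GaloisRepresentations.IsNonarchimedeanLocalField

variable {F : Type} [Field F] [ValuativeRel F] [TopologicalSpace F] [IsNonarchimedeanLocalField F]
  [CharZero F] {p : ℕ} [Fact p.Prime] [Fact (¬ IsUnit (p : integerC F))]
  [IsAdicComplete (Ideal.span {(p : integerC F)}) (integerC F)]

/-! ### Ring maps on integer powers of units -/

omit [ValuativeRel F] [TopologicalSpace F] [IsNonarchimedeanLocalField F] [CharZero F] [Fact p.Prime]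
  [Fact (¬ IsUnit (p : integerC F))] [IsAdicComplete (Ideal.span {(p : integerC F)}) (integerC F)] in
/-- A ring map into a field on integer powers of units. [folklore] -/
theorem ringHom_units_zpow {R K : Type*} [CommRing R] [Field K] (f : R →+* K) (d : Rˣ) : ∀ i : ℤ,
    f ((d ^ i : Rˣ) : R) = f (d : R) ^ i
  | (n : ℕ) => by rw [zpow_natCast, zpow_natCast, Units.val_pow_eq_pow_val, map_pow]
  | Int.negSucc n => by
    rw [zpow_negSucc, zpow_negSucc]
    refine eq_inv_of_mul_eq_one_left ?_
    rw [← map_pow, ← map_mul, ← Units.val_pow_eq_pow_val, Units.inv_mul, map_one]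

/-! ### `θ(k_σ)` is the cyclotomic character -/

variable (hp : valuation F p < 1) (hF : Function.Surjective (fontaineTheta (integerC F) p))

/-- `θ(χ(σ)) = χ(σ)` in `ℂ_F`: the image of `ℤ_p → 𝔸_inf → B_dR⁺ → ℂ_F` is the canonical one.
[folklore] -/
theorem coe_fontaineTheta_zpToAinf (a : ℤ_[p]) :
    ((fontaineTheta (integerC F) p (zpToAinf a : Ainf (p := p) F) : integerC F) : CompletedAlgClosure F) =
      algebraMap F (CompletedAlgClosure F) (LocalField.padicRingHom F p hp (a : ℚ_[p])) := by
  rw [fontaineTheta_zpToAinf hp, coe_toIntC]; rfl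

include hF in
/-- **`σ(u) = k_σ u` with `θ(k_σ) = χ(σ)`**, the cyclotomic character viewed in `ℂ_F` through
`ℤ_p ⊆ ℚ_p → F → ℂ_F`. [cite: FontaineAsterisque223III, Exp. II §1.5.4] -/
theorem exists_galBdRPlus_uBdR_eq_mul_cyclotomic (σ : absoluteGaloisGroup F) :
    ∃ k : BDeRhamPlus (integerC F) p, galBdRPlus σ uBdR = k * uBdR ∧
      thetaBdR k = algebraMap F (CompletedAlgClosure F)
        (LocalField.padicRingHom F p hp (((GaloisRep.cyclotomicCharacter F p σ : ℤ_[p]ˣ) : ℤ_[p]) : ℚ_[p])) := by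
  obtain ⟨k, hk, hθ⟩ := exists_galBdRPlus_uBdR_eq_mul (F := F) (p := p) hF σ
  exact ⟨k, hk, by rw [hθ, coe_fontaineTheta_zpToAinf hp]⟩

/-! ### Invariants: a nonzero invariant element is a unit of `B_dR⁺` -/

section Invariants

variable [IsDomain (BDeRhamPlus (integerC F) p)]

include hp hF in
/-- **A nonzero `Γ_F`-invariant element of `B_dR(F)` is (the image of) a unit of `B_dR⁺(F)`**:
writing `x = u^m w`, invariance and `θ` give `χ(σ)^m σ(θ w) = θ w`, and Tate's theorem forces `m = 0`.
[cite: FontaineAsterisque223III, Exp. II §1.5.7] [cite: FontaineOuyang2022, Thm. 5.2.6] -/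
theorem exists_unit_of_forall_smul_eq {x : FracBdR F p} (hx0 : x ≠ 0)
    (hx : ∀ σ : absoluteGaloisGroup F, σ • x = x) :
    ∃ w : (BDeRhamPlus (integerC F) p)ˣ, x = algebraMap (BDeRhamPlus (integerC F) p) (FracBdR F p) (w : BDeRhamPlus (integerC F) p) := by
  obtain ⟨m, w, rfl⟩ := exists_eq_uBdR_zpow_mul hF hx0
  suffices hm : m = 0 by exact ⟨w, by rw [hm, zpow_zero, one_mul]⟩
  by_contra hm
  have hu0 : algebraMap (BDeRhamPlus (integerC F) p) (FracBdR F p) uBdR ≠ 0 := fun h => hx0 (by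
    rw [h, zero_zpow m hm, zero_mul])
  -- for each `σ`: `χ(σ)^m · σ(θ w) = θ w`
  have key : ∀ σ : absoluteGaloisGroup F, σ • thetaBdR (w : BDeRhamPlus (integerC F) p) =
      (algebraMap F (CompletedAlgClosure F)
        (LocalField.padicRingHom F p hp (((GaloisRep.cyclotomicCharacter F p σ : ℤ_[p]ˣ) : ℤ_[p]) : ℚ_[p]))) ^ (-m) *
          thetaBdR (w : BDeRhamPlus (integerC F) p) := by
    intro σ
    obtain ⟨k, hk, hθk⟩ := exists_galBdRPlus_uBdR_eq_mul_cyclotomic hp hF σ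
    have hkunit : IsUnit k := by
      rw [isUnit_iff_thetaBdR_ne_zero hF, hθk, map_ne_zero_iff _ (algebraMap F (CompletedAlgClosure F)).injective,
        map_ne_zero_iff _ (LocalField.padicRingHom F p hp).injective]
      exact PadicInt.coe_ne_zero.2 (GaloisRep.cyclotomicCharacter F p σ).ne_zero
    -- invariance in `B_dR`
    have h1 := hx σ
    rw [smul_mul', smul_fracBdR_eq_toRingHom σ (_ ^ m), map_zpow₀, ← smul_fracBdR_eq_toRingHom, smul_algebraMap_fracBdR,
      smul_algebraMap_fracBdR, hk, map_mul, mul_zpow, mul_assoc, mul_left_comm] at h1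
    have h2 := mul_left_cancel₀ (zpow_ne_zero m hu0) h1
    -- `h2 : a(k)^m * a(σ w) = a(w)`; pass to `B_dR⁺` via units and apply `θ`
    rw [← IsUnit.unit_spec hkunit, ← ringHom_units_zpow, ← map_mul, (algebraMap_fracBdR_injective (F := F) (p := p)).eq_iff] at h2
    have h3 := congrArg thetaBdR h2
    rw [map_mul, ringHom_units_zpow, IsUnit.unit_spec, hθk, thetaBdR_galBdRPlus] at h3
    -- `h3 : c^m * σ•θw = θw`
    have hc0 : (algebraMap F (CompletedAlgClosure F)
        (LocalField.padicRingHom F p hp (((GaloisRep.cyclotomicCharacter F p σ : ℤ_[p]ˣ) : ℤ_[p]) : ℚ_[p]))) ≠ 0 := by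
      rw [map_ne_zero_iff _ (algebraMap F (CompletedAlgClosure F)).injective,
        map_ne_zero_iff _ (LocalField.padicRingHom F p hp).injective]
      exact PadicInt.coe_ne_zero.2 (GaloisRep.cyclotomicCharacter F p σ).ne_zero
    rw [zpow_neg, eq_inv_mul_iff_mul_eq₀ (zpow_ne_zero m hc0)]
    exact h3
  have hzero := CompletedAlgClosure.eq_zero_of_forall_smul_eq_cyclotomicCharacter_zpow hp (neg_ne_zero.2 hm) key
  exact ((isUnit_iff_thetaBdR_ne_zero hF _).1 w.isUnit) hzero

include hp hF in
/-- **`B_dR(F)^{Γ_F} = F`** (the image of `F ↪ B_dR⁺ ⊆ B_dR`). [cite: FontaineAsterisque223III, Exp. II §1.5.7]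
[cite: FontaineOuyang2022, Thm. 5.2.6] -/
theorem fixedPoints_fracBdR_eq_range :
    {x : FracBdR F p | ∀ σ : absoluteGaloisGroup F, σ • x = x} =
      Set.range (letI := fracAlgebra (p := p) hp hF; algebraMap F (FracBdR F p)) := by
  letI := fracAlgebra (p := p) hp hF
  refine Set.Subset.antisymm (fun x hx => ?_) ?_
  · change ∀ σ : absoluteGaloisGroup F, σ • x = x at hx
    by_cases hx0 : x = 0
    · exact ⟨0, by rw [map_zero, hx0]⟩
    obtain ⟨w, rfl⟩ := exists_unit_of_forall_smul_eq hp hF hx0 hx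
    -- `σ w = w`, so `θ w ∈ ℂ_F^Γ = F`
    have hw : ∀ σ : absoluteGaloisGroup F, galBdRPlus σ (w : BDeRhamPlus (integerC F) p) = w := fun σ =>
      algebraMap_fracBdR_injective (by rw [← smul_algebraMap_fracBdR, hx σ])
    have hθw : thetaBdR (w : BDeRhamPlus (integerC F) p) ∈ Set.range (algebraMap F (CompletedAlgClosure F)) := by
      rw [← CompletedAlgClosure.fixedPoints_eq_range_algebraMap]
      intro σ
      rw [← thetaBdR_galBdRPlus, hw σ]
    obtain ⟨f, hf⟩ := hθw
    -- `x' = w − f` is invariant with `θ x' = 0`, hence `0`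
    set x' : FracBdR F p := algebraMap (BDeRhamPlus (integerC F) p) (FracBdR F p) ((w : BDeRhamPlus (integerC F) p) - embBdRHom hp hF f) with hx'
    have hx'inv : ∀ σ : absoluteGaloisGroup F, σ • x' = x' := fun σ => by
      rw [hx', map_sub, smul_sub, ← algebraMap_fracAlgebra, smul_algebraMap_fracAlgebra, hx σ]
    by_cases hx'0 : x' = 0
    · refine ⟨f, ?_⟩
      rw [hx', map_sub, sub_eq_zero] at hx'0
      rw [algebraMap_fracAlgebra, ← hx'0]
    · exfalso
      obtain ⟨w', hw'⟩ := exists_unit_of_forall_smul_eq hp hF hx'0 hx'inv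
      rw [hx'] at hw'
      have h1 := algebraMap_fracBdR_injective hw'
      have h2 := congrArg thetaBdR h1
      rw [map_sub, thetaBdR_embBdRHom, ← hf, sub_self] at h2
      exact ((isUnit_iff_thetaBdR_ne_zero hF _).1 w'.isUnit) h2.symm
  · rintro _ ⟨f, rfl⟩ σ
    exact smul_algebraMap_fracAlgebra hp hF σ f

include hp hF in
/-- **Fontaine's regularity (ii) for `B_dR(F)`**: if `b/c` is `Γ_F`-invariant then `b ∈ F·c`.
[cite: FontaineAsterisque223III, Exp. III §1.4] -/
theorem exists_smul_eq_fracBdR (b c : FracBdR F p) (hc : c ≠ 0)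
    (h : ∀ σ : absoluteGaloisGroup F, σ • b * c = b * σ • c) :
    ∃ e : F, b = (letI := fracAlgebra (p := p) hp hF; e • c) := by
  letI := fracAlgebra (p := p) hp hF
  have hinv : ∀ σ : absoluteGaloisGroup F, σ • (b / c) = b / c := by
    intro σ
    have hσc : σ • c ≠ 0 := fun h0 => hc (by
      have := congrArg (fun y => σ⁻¹ • y) h0
      simpa only [inv_smul_smul, smul_zero] using this)
    have hdiv : σ • (b / c) = σ • b / σ • c := by rw [div_eq_mul_inv, div_eq_mul_inv, smul_mul', smul_inv'']
    rw [hdiv, div_eq_div_iff hσc hc]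
    exact h σ
  have hmem : b / c ∈ {x : FracBdR F p | ∀ σ : absoluteGaloisGroup F, σ • x = x} := hinv
  rw [fixedPoints_fracBdR_eq_range hp hF] at hmem
  obtain ⟨e, he⟩ := hmem
  refine ⟨e, ?_⟩
  rw [Algebra.smul_def, he, div_mul_cancel₀ _ hc]

end Invariants

/-! ### The datum -/

/-- **`B_dR(F)` as a period-ring datum** `(B_dR, Γ_F ↷, F ⊆ B_dR, Fil^• = ξ^• B_dR⁺)` with Fontaine's
regularity: `B_dR^{Γ_F} = F`, `(Frac B_dR)^{Γ_F} = F` (it is a field), stable lines are spanned by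
units, and the decreasing exhaustive separated multiplicative `Γ_F`-stable filtration.
[cite: FontaineAsterisque223III, Exp. II §1.5, Exp. III §1.5] [cite: FontaineOuyang2022, Thm. 5.2.6] -/
def bdRPeriodRingData (hp : valuation F p < 1) [Algebra ℚ_[p] F] :
    PeriodRingData.{0, 0, 0, 0} (absoluteGaloisGroup F) ℚ_[p] F :=
  have hF : Function.Surjective (fontaineTheta (integerC F) p) := surjective_fontaineTheta_integerC hp
  haveI : IsDomain (BDeRhamPlus (integerC F) p) := isDomain_bDeRhamPlus hF
  letI : Algebra F (FracBdR F p) := fracAlgebra (p := p) hp hF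
  haveI : SMulCommClass (absoluteGaloisGroup F) F (FracBdR F p) := smulCommClass_fracBdR hp hF
  { B := FracBdR F p
    invariants_eq := fixedPoints_fracBdR_eq_range hp hF
    exists_smul_eq := exists_smul_eq_fracBdR hp hF
    isUnit_of_smul_mem := fun _ hb _ => isUnit_iff_ne_zero.2 hb
    fil := fil hp hF
    fil_antitone := fil_antitone hp hF
    mul_mem_fil := mul_mem_fil hp hF
    one_mem_fil_zero := one_mem_fil_zero hp hF
    smul_mem_fil := smul_mem_fil hp hF
    iSup_fil := iSup_fil hp hF
    iInf_fil := iInf_fil hp hF }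

/-- The period ring of `bdRPeriodRingData` is `B_dR(F) = Frac B_dR⁺(F)`. [folklore] -/
theorem bdRPeriodRingData_B (hp : valuation F p < 1) [Algebra ℚ_[p] F] :
    (bdRPeriodRingData (F := F) (p := p) hp).B = FracBdR F p := rfl



end Literature.NumberTheory.PAdicHodge

end
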